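/-
Copyright (c) 2026 the pub-hodgecm2 formalisation cell (harness21).  New file, outside the frozen port manifest.
Origin: seat `prover-pub-hodgecm2-d2bridge-prove-2-g6-0` (Δ2 BRIDGE; ι₁∕Id CHAIN, ASSEMBLER MODULE TABLE v1.2∕v1.3 row I7b, pen; «b» = d2bridge-wb-3), 2026-08-24.
The UNTWISTED twin of ✔ `CorCM/D2Bridge/PinSignatures.lean` (p370763, assembler g1): `thm418C_ofTower_of_pinsId` and `thm418C_liuDictionaryPin_of_pinsId`
— the SAME two theorems (#2, #1 of d2bridge-prove-1's census `HOME/d2bridge/iota1/I7b-PinSignatures/CENSUS-prove1.md`) with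
`C : Sec42Data (Model.honestP5IdOf h …) isotropicAt` (`X_K := M_K`, ✔ `HComp/HonestP5Id.lean` p373641) and the engine `…_perLine_smallId`
(`D2Bridge/Iota1/Thm418COfPieces.lean`); the original's section `variable`s are written as EXPLICIT per-theorem binders (same order), the binder TEXT is
otherwise byte-identical, so the ι₁∕Id-chain pin rows inhabit EXACTLY these types at ℭ₁ := `Model.sec42DataIdOf h isoOf F ι₁ V Φ`.  THEOREMS ONLY; no `def`,
no instance, no notation, no named fact introduced, no `sorry`.  HC_CM is NOT proved; «Δ2 BRIDGE CLOSED» is NOT claimed.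
-/
import Summits.HodgeConjecture.CorCM.D2Bridge.Iota1.Thm418COfPieces
import Summits.HodgeConjecture.CorCM.D2Bridge.PinSignatures
import HarnessLib

/-!
# ι₁∕Id chain, I7b (3∕3): `PinSignatures` over the UNTWISTED datum (`X_K := M_K`)

* `PinSignatures.thm418C_ofTower_of_pinsId` — [Thm 4.18] AS PRINTED + Ω-pin (b) + J-pin (c) + pieces (d) below the threshold + [Prop 4.13] LITERAL
  ⟹ `T.Thm418C` at the TOWER dictionary `T := LiuDictionary.ofTower …` (fields unfolded, all `rfl`), over `C : Sec42Data (Model.honestP5IdOf h …) _`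
  — theorem #3 `LiuDictionary.thm418C_of_asPrinted_of_prop413AsPrinted_perLine_smallId` at the tower dictionary;
* `PinSignatures.thm418C_liuDictionaryPin_of_pinsId` — its `rfl`-specialisation at the LITERAL pin `liuDictionaryPin hHD hI h₁ h₃ hA V I line`
  (`Char := I`, `Adm i := {χ // (line i).IsAutChar χ}`, `χof i a := a.1`, `ιV := ιVE V`, `PhiMu i := PhiMuLine ι₁ (line i)`,
  `adm i dd := dd.IsReflexOfTypeG ι₁ (typeOfLine (line i))`).
References: [Liu2021] Thm. 4.18 (FJcycle.tex l. 2232–2245), Prop. 4.13, Def. 4.11, App. D Lem. D.1 (1),(3).  HC_CM is NOT proved.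
-/

set_option autoImplicit false

noncomputable section

namespace Summit.HodgeConjecture.CorCM.D2Bridge.PinSignatures

open HodgeCM HodgeCM.Model NumberField
open HodgeCM.Literature.Theta HodgeCM.Literature.Theta.LiuAlbaneseModuleDatum
open HodgeCM.Literature.Theta.LiuAlbaneseModuleDatum.D2Bridge
open Summit.HodgeConjecture.CorCM
open Literature.AlgebraicGeometry.ShimuraVarieties.UnitaryCanonicalModel
open Literature.NumberTheory.Automorphic.Liu2021 Literature.NumberTheory.Automorphic.Liu2021.AppendixC
open Literature.RepresentationTheory
open Literature.AlgebraicGeometry.HodgeTheory Literature.NumberTheory.Automorphic.PicardCM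
open Literature.NumberTheory.Automorphic
open Literature.NumberTheory.Transcendental (Arapura2012_Cor_15_4_6)
open HodgeCM.Model.TowerCarrier

universe v₃

set_option synthInstance.maxHeartbeats 400000 in
set_option maxHeartbeats 1600000 in
/-- **VERSION-B: [Thm 4.18] AS PRINTED + the Ω-PIN (b) + the J-PIN (c) + the PIECES (d) below the threshold + [Prop 4.13] LITERAL ⟹ `T.Thm418C`
at the TOWER DICTIONARY** — theorem 3 of `Thm418COfPieces` at `T := LiuDictionary.ofTower …`; every binder type below is displayed with the
tower dictionary's fields UNFOLDED (`T.Char = Char`, `T.Adm i = Adm i`, `T.Ω i a = (line i).Ω ιV (χof i a)`, `T.PhiMu = PhiMu`,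
`T.H = Tower …`, `T.res K = resTotal … K` — all `rfl`), so that the pin seats inhabit EXACTLY these types. -/
theorem thm418C_ofTower_of_pinsId
    {hHD : Literature.AlgebraicGeometry.HodgeTheory.exists_isReal_hodgeModel}
    {hI : Literature.AlgebraicGeometry.HodgeTheory.hodgePQ_independent_of_hodgeModel}
    {h₁ : Literature.NumberTheory.Automorphic.PicardCM.BallQuotientUniformised}
    {h₃ : Literature.NumberTheory.Automorphic.PicardCM.CMAbelianVarietyRealised}
    {hA : Arapura2012_Cor_15_4_6}
    {L : HodgeCM.CMField} {ι₁ : (L : Type) →+* ℂ} (V : HodgeCM.HermSpace3 L ι₁)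
    {JV : Matrix (Fin 3) (Fin 3) (L : Type)} {TV : Matrix (Fin 3) (Fin 3) ↥(maximalRealSubfield (L : Type))}
    {δ : (L : Type)} {hcδ : IsCMField.complexConj (L : Type) δ = -δ} {hδ : δ ≠ 0} {d : ↥(maximalRealSubfield (L : Type))}
    {hd : δ * δ = algebraMap _ (L : Type) d} {hV : TV.IsSymm} {hVd : IsUnit TV.det}
    {hJV : JV = TV.map (algebraMap _ (L : Type))}
    (ιV : ↥V.adelicFin →*
      ↥(UnitaryGroup.finAdelic (↥(maximalRealSubfield (L : Type))) (L : Type) (IsCMField.complexConj (L : Type)) 3 JV))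
    (Char : Type) (Adm : Char → Type) (line : Char → SplitLine JV TV hcδ hδ hd hV hVd hJV)
    (χof : (i : Char) → Adm i → (line i).CharW) (PhiMu : Char → Prop) (adm : Char → LiuCMSide → Prop)
    (h : exists_recordSystem) (Φ : Literature.AlgebraicGeometry.Motives.CMType L)
    {isotropicAt : ℕ → Prop}
    (C : Sec42Data (Model.honestP5IdOf h ⟨L.K⟩ ι₁ ⟨V.Hm, V.isHermitian, V.signature_ι₁, V.posDef_of_ne⟩ Φ) isotropicAt)
    (Good : Char → Prop) (hbad : ∀ i : Char, PhiMu i → ¬ Good i → (HodgeCM.Model.LiuDictionary.ofTower hHD hI h₁ h₃ hA V Char Adm (fun i a => (line i).Ω ιV (χof i a)) PhiMu adm).block i = ⊥)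
    -- (a) the RESTS OF RECORD at δ′: PER-LINE uniform carriers `U i hμ hg` (DECISION #9) + tails (d2bridge-prove-1 ∕ -4, `OmegaAtDeltaPrime.lean`; own-htheta's `uniformOmegaD` at δ′)
    (U : ∀ i : Char, PhiMu i → Good i → UniformOmega C) (R₀ : ∀ i : Char, PhiMu i → Good i → Thm418Rest C)
    (tail : ∀ (i : Char) (hμ : PhiMu i) (hg : Good i), RestTail C (R₀ i hμ hg).μ (R₀ i hμ hg).isConjugateSymplectic)
    (hLiu : ∀ (i : Char) (hμ : PhiMu i) (hg : Good i), Thm418AsPrinted (toThm418Data C ((U i hμ hg).rest (tail i hμ hg))))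
    -- (b) the Ω-PIN at δ′ (d2bridge-prove-6 ∕ -7): σ ∕ hσ ∕ e ∕ he
    (σ : ∀ (i : Char) (hμ : PhiMu i) (hg : Good i), Adm i → (toThm418Data C ((U i hμ hg).rest (tail i hμ hg))).AdmIndex)
    (hσ : ∀ (i : Char) (hμ : PhiMu i) (hg : Good i), Function.Injective (σ i hμ hg))
    (e : ∀ (i : Char) (hμ : PhiMu i) (hg : Good i) (a : Adm i),
      (line i).Ω ιV (χof i a) ≃ₗ[ℂ] (toThm418Data C ((U i hμ hg).rest (tail i hμ hg))).omegaAt (σ i hμ hg a))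
    (he : ∀ (i : Char) (hμ : PhiMu i) (hg : Good i) (a : Adm i) (g : ↥V.adelicFin) (m : (line i).Ω ιV (χof i a)),
      e i hμ hg a (MonoidAlgebra.of ℂ ↥V.adelicFin g • m) = (toThm418Data C ((U i hμ hg).rest (tail i hμ hg))).rhoAt (σ i hμ hg a) g (e i hμ hg a m))
    -- (c) the J-RECORD PIN (d2bridge-prove-2 ∕ -5): M ∕ jH ∕ hjHinj ∕ hjH
    (M : ∀ (i : Char) (hμ : PhiMu i) (hg : Good i), (toThm418Data C ((U i hμ hg).rest (tail i hμ hg))).Map43RationalData)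
    (jH : ∀ (i : Char) (hμ : PhiMu i) (hg : Good i), (M i hμ hg).HB →ₗ[ℂ] (HodgeCM.Model.LiuDictionary.ofTower hHD hI h₁ h₃ hA V Char Adm (fun i a => (line i).Ω ιV (χof i a)) PhiMu adm).H)
    (hjHinj : ∀ (i : Char) (hμ : PhiMu i) (hg : Good i), Function.Injective (jH i hμ hg))
    (hjH : ∀ (i : Char) (hμ : PhiMu i) (hg : Good i) (g : ↥V.adelicFin) (x : (M i hμ hg).HB),
      jH i hμ hg ((M i hμ hg).ρB g x) = MonoidAlgebra.of ℂ ↥V.adelicFin g • jH i hμ hg x)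
    -- (d) the PIECES below the threshold (d2bridge-prove-3 ∕ -8)
    (Ks : Char → HodgeCM.Level V)
    (pieces : ∀ (i : Char) (hμ : PhiMu i) (hg : Good i) (K : HodgeCM.Level V), K ≤ Ks i →
      HcmPieces.{0, v₃, 0} (toThm418Data C ((U i hμ hg).rest (tail i hμ hg))) (M i hμ hg) (HodgeCM.Model.LiuDictionary.ofTower hHD hI h₁ h₃ hA V Char Adm (fun i a => (line i).Ω ιV (χof i a)) PhiMu adm).H (jH i hμ hg) K.K
        ((HodgeCM.Model.picardCMUniverse hHD hI h₁ h₃).CohC ((HodgeCM.Model.picardCMUniverse hHD hI h₁ h₃).pms L ι₁ V K) 1)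
        (resTotal hHD hI (ballQuotientUniformisedDatum_of h₁) h₃ hA K) ((HodgeCM.Model.LiuDictionary.ofTower hHD hI h₁ h₃ hA V Char Adm (fun i a => (line i).Ω ιV (χof i a)) PhiMu adm).cmClasses K i))
    -- [Lem D.1 (1)] at the rests (from the δ′ file: `nontrivial_omegaAt_restOfCharRep_of_lemD1AsPrinted`)
    (hnvD : ∀ (i : Char) (hμ : PhiMu i) (hg : Good i) (j : (toThm418Data C ((U i hμ hg).rest (tail i hμ hg))).AdmIndex),
      Nontrivial ((toThm418Data C ((U i hμ hg).rest (tail i hμ hg))).omegaAt j))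
    -- [Prop 4.13] LITERAL, once per good line, over `(U i hμ hg).prop413Data (Tower …)` + [Def 4.11] + [Lem D.1 (3)] + `hK` (DECISION #9)
    (h413 : ∀ (i : Char) (hμ : PhiMu i) (hg : Good i), Prop413AsPrinted ((U i hμ hg).prop413Data (HodgeCM.Model.LiuDictionary.ofTower hHD hI h₁ h₃ hA V Char Adm (fun i a => (line i).Ω ιV (χof i a)) PhiMu adm).H))
    (h411 : ∀ (i : Char) (hμ : PhiMu i) (hg : Good i) (t : ((U i hμ hg).prop413Data (HodgeCM.Model.LiuDictionary.ofTower hHD hI h₁ h₃ hA V Char Adm (fun i a => (line i).Ω ιV (χof i a)) PhiMu adm).H).AdmTriple), IsIrreducibleOrZero (((U i hμ hg).prop413Data (HodgeCM.Model.LiuDictionary.ofTower hHD hI h₁ h₃ hA V Char Adm (fun i a => (line i).Ω ιV (χof i a)) PhiMu adm).H).rhoAt t) ∧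
      IsSmoothRep (((U i hμ hg).prop413Data (HodgeCM.Model.LiuDictionary.ofTower hHD hI h₁ h₃ hA V Char Adm (fun i a => (line i).Ω ιV (χof i a)) PhiMu adm).H).rhoAt t) ∧ IsAdmissibleRep (((U i hμ hg).prop413Data (HodgeCM.Model.LiuDictionary.ofTower hHD hI h₁ h₃ hA V Char Adm (fun i a => (line i).Ω ιV (χof i a)) PhiMu adm).H).rhoAt t))
    (hsep : ∀ (i : Char) (hμ : PhiMu i) (hg : Good i) (s t : ((U i hμ hg).prop413Data (HodgeCM.Model.LiuDictionary.ofTower hHD hI h₁ h₃ hA V Char Adm (fun i a => (line i).Ω ιV (χof i a)) PhiMu adm).H).AdmTriple), Nontrivial (((U i hμ hg).prop413Data (HodgeCM.Model.LiuDictionary.ofTower hHD hI h₁ h₃ hA V Char Adm (fun i a => (line i).Ω ιV (χof i a)) PhiMu adm).H).omegaAt s) →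
      (∃ f : ((U i hμ hg).prop413Data (HodgeCM.Model.LiuDictionary.ofTower hHD hI h₁ h₃ hA V Char Adm (fun i a => (line i).Ω ιV (χof i a)) PhiMu adm).H).omegaAt s ≃ₗ[ℂ] ((U i hμ hg).prop413Data (HodgeCM.Model.LiuDictionary.ofTower hHD hI h₁ h₃ hA V Char Adm (fun i a => (line i).Ω ιV (χof i a)) PhiMu adm).H).omegaAt t,
        ∀ (g : ↥V.adelicFin) (v : ((U i hμ hg).prop413Data (HodgeCM.Model.LiuDictionary.ofTower hHD hI h₁ h₃ hA V Char Adm (fun i a => (line i).Ω ιV (χof i a)) PhiMu adm).H).omegaAt s),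
          f (((U i hμ hg).prop413Data (HodgeCM.Model.LiuDictionary.ofTower hHD hI h₁ h₃ hA V Char Adm (fun i a => (line i).Ω ιV (χof i a)) PhiMu adm).H).rhoAt s g v) = ((U i hμ hg).prop413Data (HodgeCM.Model.LiuDictionary.ofTower hHD hI h₁ h₃ hA V Char Adm (fun i a => (line i).Ω ιV (χof i a)) PhiMu adm).H).rhoAt t g (f v)) → s = t)
    (hK : ∃ K : Subgroup ↥V.adelicFin, IsOpenCompact K) :
    (HodgeCM.Model.LiuDictionary.ofTower hHD hI h₁ h₃ hA V Char Adm (fun i a => (line i).Ω ιV (χof i a)) PhiMu adm).Thm418C :=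
  HodgeCM.Model.LiuDictionary.thm418C_of_asPrinted_of_prop413AsPrinted_perLine_smallId V h Φ C (HodgeCM.Model.LiuDictionary.ofTower hHD hI h₁ h₃ hA V Char Adm (fun i a => (line i).Ω ιV (χof i a)) PhiMu adm) Good hbad U R₀ tail hLiu σ hσ e he M jH hjHinj hjH
    Ks pieces hnvD h413 h411 hsep hK

set_option synthInstance.maxHeartbeats 400000 in
set_option maxHeartbeats 1600000 in
/-- **VERSION-B at the LITERAL PIN: [Thm 4.18] AS PRINTED + Ω-PIN + J-PIN + PIECES + [Prop 4.13] LITERAL ⟹ `(liuDictionaryPin …).Thm418C`.** -/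
theorem thm418C_liuDictionaryPin_of_pinsId
    {hHD : Literature.AlgebraicGeometry.HodgeTheory.exists_isReal_hodgeModel}
    {hI : Literature.AlgebraicGeometry.HodgeTheory.hodgePQ_independent_of_hodgeModel}
    {h₁ : Literature.NumberTheory.Automorphic.PicardCM.BallQuotientUniformised}
    {h₃ : Literature.NumberTheory.Automorphic.PicardCM.CMAbelianVarietyRealised}
    {hA : Arapura2012_Cor_15_4_6}
    {L : HodgeCM.CMField} {ι₁ : (L : Type) →+* ℂ} (V : HodgeCM.HermSpace3 L ι₁)
    (I : Type) (line : I → SplitLineE V)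
    (h : exists_recordSystem) (Φ : Literature.AlgebraicGeometry.Motives.CMType L)
    {isotropicAt : ℕ → Prop}
    (C : Sec42Data (Model.honestP5IdOf h ⟨L.K⟩ ι₁ ⟨V.Hm, V.isHermitian, V.signature_ι₁, V.posDef_of_ne⟩ Φ) isotropicAt)
    (Good : I → Prop) (hbad : ∀ i : I, SplitLine.PhiMuLine ι₁ (line i) → ¬ Good i → (HodgeCM.Model.liuDictionaryPin hHD hI h₁ h₃ hA V I line).block i = ⊥)
    (U : ∀ i : I, SplitLine.PhiMuLine ι₁ (line i) → Good i → UniformOmega C) (R₀ : ∀ i : I, SplitLine.PhiMuLine ι₁ (line i) → Good i → Thm418Rest C)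
    (tail : ∀ (i : I) (hμ : SplitLine.PhiMuLine ι₁ (line i)) (hg : Good i), RestTail C (R₀ i hμ hg).μ (R₀ i hμ hg).isConjugateSymplectic)
    (hLiu : ∀ (i : I) (hμ : SplitLine.PhiMuLine ι₁ (line i)) (hg : Good i), Thm418AsPrinted (toThm418Data C ((U i hμ hg).rest (tail i hμ hg))))
    -- (b) Ω-PIN at the literal pin
    (σ : ∀ (i : I) (hμ : SplitLine.PhiMuLine ι₁ (line i)) (hg : Good i),
      {χ : (line i).CharW // (line i).IsAutChar χ} → (toThm418Data C ((U i hμ hg).rest (tail i hμ hg))).AdmIndex)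
    (hσ : ∀ (i : I) (hμ : SplitLine.PhiMuLine ι₁ (line i)) (hg : Good i), Function.Injective (σ i hμ hg))
    (e : ∀ (i : I) (hμ : SplitLine.PhiMuLine ι₁ (line i)) (hg : Good i) (a : {χ : (line i).CharW // (line i).IsAutChar χ}),
      (line i).Ω (ιVE V) a.1 ≃ₗ[ℂ] (toThm418Data C ((U i hμ hg).rest (tail i hμ hg))).omegaAt (σ i hμ hg a))
    (he : ∀ (i : I) (hμ : SplitLine.PhiMuLine ι₁ (line i)) (hg : Good i) (a : {χ : (line i).CharW // (line i).IsAutChar χ})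
      (g : ↥V.adelicFin) (m : (line i).Ω (ιVE V) a.1),
      e i hμ hg a (MonoidAlgebra.of ℂ ↥V.adelicFin g • m) = (toThm418Data C ((U i hμ hg).rest (tail i hμ hg))).rhoAt (σ i hμ hg a) g (e i hμ hg a m))
    -- (c) J-RECORD PIN
    (M : ∀ (i : I) (hμ : SplitLine.PhiMuLine ι₁ (line i)) (hg : Good i), (toThm418Data C ((U i hμ hg).rest (tail i hμ hg))).Map43RationalData)
    (jH : ∀ (i : I) (hμ : SplitLine.PhiMuLine ι₁ (line i)) (hg : Good i), (M i hμ hg).HB →ₗ[ℂ] (HodgeCM.Model.liuDictionaryPin hHD hI h₁ h₃ hA V I line).H)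
    (hjHinj : ∀ (i : I) (hμ : SplitLine.PhiMuLine ι₁ (line i)) (hg : Good i), Function.Injective (jH i hμ hg))
    (hjH : ∀ (i : I) (hμ : SplitLine.PhiMuLine ι₁ (line i)) (hg : Good i) (g : ↥V.adelicFin) (x : (M i hμ hg).HB),
      jH i hμ hg ((M i hμ hg).ρB g x) = MonoidAlgebra.of ℂ ↥V.adelicFin g • jH i hμ hg x)
    -- (d) PIECES below the threshold
    (Ks : I → HodgeCM.Level V)
    (pieces : ∀ (i : I) (hμ : SplitLine.PhiMuLine ι₁ (line i)) (hg : Good i) (K : HodgeCM.Level V), K ≤ Ks i →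
      HcmPieces.{0, v₃, 0} (toThm418Data C ((U i hμ hg).rest (tail i hμ hg))) (M i hμ hg) (HodgeCM.Model.liuDictionaryPin hHD hI h₁ h₃ hA V I line).H (jH i hμ hg) K.K
        ((HodgeCM.Model.picardCMUniverse hHD hI h₁ h₃).CohC ((HodgeCM.Model.picardCMUniverse hHD hI h₁ h₃).pms L ι₁ V K) 1)
        (resTotal hHD hI (ballQuotientUniformisedDatum_of h₁) h₃ hA K) ((HodgeCM.Model.liuDictionaryPin hHD hI h₁ h₃ hA V I line).cmClasses K i))
    (hnvD : ∀ (i : I) (hμ : SplitLine.PhiMuLine ι₁ (line i)) (hg : Good i) (j : (toThm418Data C ((U i hμ hg).rest (tail i hμ hg))).AdmIndex),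
      Nontrivial ((toThm418Data C ((U i hμ hg).rest (tail i hμ hg))).omegaAt j))
    (h413 : ∀ (i : I) (hμ : SplitLine.PhiMuLine ι₁ (line i)) (hg : Good i), Prop413AsPrinted ((U i hμ hg).prop413Data (HodgeCM.Model.liuDictionaryPin hHD hI h₁ h₃ hA V I line).H))
    (h411 : ∀ (i : I) (hμ : SplitLine.PhiMuLine ι₁ (line i)) (hg : Good i) (t : ((U i hμ hg).prop413Data (HodgeCM.Model.liuDictionaryPin hHD hI h₁ h₃ hA V I line).H).AdmTriple), IsIrreducibleOrZero (((U i hμ hg).prop413Data (HodgeCM.Model.liuDictionaryPin hHD hI h₁ h₃ hA V I line).H).rhoAt t) ∧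
      IsSmoothRep (((U i hμ hg).prop413Data (HodgeCM.Model.liuDictionaryPin hHD hI h₁ h₃ hA V I line).H).rhoAt t) ∧ IsAdmissibleRep (((U i hμ hg).prop413Data (HodgeCM.Model.liuDictionaryPin hHD hI h₁ h₃ hA V I line).H).rhoAt t))
    (hsep : ∀ (i : I) (hμ : SplitLine.PhiMuLine ι₁ (line i)) (hg : Good i) (s t : ((U i hμ hg).prop413Data (HodgeCM.Model.liuDictionaryPin hHD hI h₁ h₃ hA V I line).H).AdmTriple), Nontrivial (((U i hμ hg).prop413Data (HodgeCM.Model.liuDictionaryPin hHD hI h₁ h₃ hA V I line).H).omegaAt s) →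
      (∃ f : ((U i hμ hg).prop413Data (HodgeCM.Model.liuDictionaryPin hHD hI h₁ h₃ hA V I line).H).omegaAt s ≃ₗ[ℂ] ((U i hμ hg).prop413Data (HodgeCM.Model.liuDictionaryPin hHD hI h₁ h₃ hA V I line).H).omegaAt t,
        ∀ (g : ↥V.adelicFin) (v : ((U i hμ hg).prop413Data (HodgeCM.Model.liuDictionaryPin hHD hI h₁ h₃ hA V I line).H).omegaAt s),
          f (((U i hμ hg).prop413Data (HodgeCM.Model.liuDictionaryPin hHD hI h₁ h₃ hA V I line).H).rhoAt s g v) = ((U i hμ hg).prop413Data (HodgeCM.Model.liuDictionaryPin hHD hI h₁ h₃ hA V I line).H).rhoAt t g (f v)) → s = t)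
    (hK : ∃ K : Subgroup ↥V.adelicFin, IsOpenCompact K) :
    (HodgeCM.Model.liuDictionaryPin hHD hI h₁ h₃ hA V I line).Thm418C :=
  thm418C_ofTower_of_pinsId V (ιVE V) I (fun i => {χ : (line i).CharW // (line i).IsAutChar χ}) line (fun _ a => a.1)
    (fun i => SplitLine.PhiMuLine ι₁ (line i)) (fun i dd => dd.IsReflexOfTypeG ι₁ (SplitLine.typeOfLine (line i)))
    h Φ C Good hbad U R₀ tail hLiu σ hσ e he M jH hjHinj hjH Ks pieces hnvD h413 h411 hsep hK

end Summit.HodgeConjecture.CorCM.D2Bridge.PinSignatures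

end
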